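import Summits.ValiantsHypothesis.ValiantsHypothesis.Theorems.LacunarySymmetroidMatrixDescartesCensusSharpRowsLog
import Summits.ValiantsHypothesis.ValiantsHypothesis.Theorems.LacunarySymmetroidMatrixDescartesCensusLogNat
import Summits.ValiantsHypothesis.ValiantsHypothesis.Theorems.LacunarySymmetroidMatrixDescartesCensusZp218On000203092035Rows3
import Summits.ValiantsHypothesis.ValiantsHypothesis.Theorems.LacunarySymmetroidMatrixDescartesCensusZp218On000203092035Rows4
import Summits.ValiantsHypothesis.ValiantsHypothesis.Theorems.LacunarySymmetroidMatrixDescartesCensusZp317On000203081933Part1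
import Summits.ValiantsHypothesis.ValiantsHypothesis.Theorems.LacunarySymmetroidMatrixDescartesCensusZp319On000203102340Rows
import Summits.ValiantsHypothesis.ValiantsHypothesis.Theorems.LacunarySymmetroidMatrixDescartesCensusZp218On000203092035Rows3

/-!
# `MatrixDescartes` census — W4 boundary layer: PARTS 1–6 of the kernel kill of `ZP(2..18)` on `(0,2,3,9,20,35)`

HONEST FRAMING.  Object-search cell `pub-symmetroid`, item `DoorA26 = PosRootLawAt 2 6 19` (stmt-ValiantsHypothesis-19979, OPEN, typed,
never asserted).  A sub-tree of the typed face-row-LP certificate behind `countP_posRoots_zp_2_18_le_on_0_2_3_9_20_35` (file `…Zp218On…`),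
split out so that every declaration stays within the default heartbeat budget and every file within 400 lines: pure real arithmetic on the
edge coefficients `c t` under hypotheses the main file derives from sharpness (circuit rows in log form, alone identities, collision
structure, bisection boxes); leaves close by `linarith` + one numeral comparison from the `…Rows` file.  Generated by the seat tool
`tools/kernel/genzp4.py`.  Nothing here is a statement about pencils by itself; nothing bounds `ζ_sym(2,6)`, decides `DoorA26`, or bears on
`MatrixDescartes` (stmt-ValiantsHypothesis-18050) / `VP ≠ VNP`.

[folklore] Elementary real arithmetic; no source.
-/

-- `Summit.ValiantsHypothesis.ValiantsHypothesis.…` repeats a component by the D-0017 layout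
-- (single-conjunct summit), which the `dupNamespace` linter flags; the name is mandated.
set_option linter.dupNamespace false

namespace Summit.ValiantsHypothesis.ValiantsHypothesis.Theorems.LacunarySymmetroidMatrixDescartes.Census

/-- Part 5 of the typed certificate of `countP_posRoots_zp_2_18_le_on_0_2_3_9_20_35`: one sub-tree of the hybrid27 kill tree, as real arithmetic on
the coefficients `c t` (hypotheses = the facts the main file derives from sharpness: circuit rows, alone identities, collision structure,
box inequalities of the enclosing bisections). Generated. [folklore] -/
theorem zp_2_18_on_0_2_3_9_20_35_pu5
    (a₀ a₁ c₃ c₄ b₁ b₃ b₄ : ℝ)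
    (ha0 : a₀ ≠ 0)
    (ha1 : a₁ ≠ 0)
    (hac03 : 0 < a₀ * c₃)
    (hac04 : 0 < a₀ * c₄)
    (hac13 : a₁ * c₃ < 0)
    (hac14 : a₁ * c₄ < 0)
    (hbb13 : 0 < b₁ * b₃)
    (hbb14 : 0 < b₁ * b₄)
    (hbx433 : |2 * (b₁ * b₄)| ≤ (1 : ℝ) * |a₁ * c₄|)
    (hbx523 : |2 * (b₁ * b₃)| ≤ ((1 : ℝ) / 2) * |a₁ * c₃|)
    (hTR1 : ¬ ((0 < a₀ * c₃) ∧ (0 < a₀ * c₄) ∧ (a₁ * c₃ < 0) ∧ (0 < b₁ * b₃) ∧ (a₁ * c₄ < 0) ∧ (0 < b₁ * b₄) ∧ (a₀ ≠ 0) ∧ (a₁ ≠ 0) ∧ (|2 * (b₁ * b₃)| ≤ ((1 : ℝ) / 2) * |a₁ * c₃|) ∧ (|2 * (b₁ * b₄)| ≤ (1 : ℝ) * |a₁ * c₄|))) :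
    False := by
  -- two-row box leaf: engine-1 box-leaf theorem via hTR1
  exact hTR1 ⟨hac03, hac04, hac13, hbb13, hac14, hbb14, ha0, ha1, hbx523, hbx433⟩

end Summit.ValiantsHypothesis.ValiantsHypothesis.Theorems.LacunarySymmetroidMatrixDescartes.Census
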